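import Summits.BirchSwinnertonDyer.BirchSwinnertonDyer.Theorems.TameQuarticManinParityTprimeHeegnerUpperOfManinUnitIrreducibleRows
import Summits.BirchSwinnertonDyer.BirchSwinnertonDyer.Theorems.RamifiedHeegnerPairLeafSigmaStarTightAllRows
import Summits.BirchSwinnertonDyer.BirchSwinnertonDyer.Theorems.SemiOrdinaryEisensteinDescentWildKolyvaginUpperAtThreeOfJointUpper
import Literature.NumberTheory.EllipticCurves.IrreducibleModPQuadraticTwistProofs
import HarnessLib

/-!
# Crux X₄ `TprimeHeegnerUpperOfManinUnit` (stmt-BirchSwinnertonDyer-23738), line `rows_of_manin_unit` v2 (3c59fc8b80b3):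
# the research stub Σ `stub_sigmaIrreducibleOptimalRows` is TIGHT — it FOLLOWS from the `3`-adic UPPER halves of BSD on
# the non-CM (t′) rows with `E[3]` irreducible (analytic rank one AND the rank-zero Heegner twists) plus print, so it
# carries NO SURPLUS over BSD₃ on its rows (§1 data level, §2 Σ VERBATIM ⟸ PUB + U₁ + U₀, §3 ⟸ PUB + BSD₃, §4 the sandwich)

HONEST FRAMING. Theorems only; helper file (`--supports stmt-BirchSwinnertonDyer-23738 --as helper`, leafhand
`leafhand-bsd-tamequarticmaninpa-4` g0, 2026-08-31); no definition, no named fact, no `sorry`; CONDITIONAL on every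
displayed input (named facts as hypotheses); no stub is closed by name, no item is closed, BSD is proved for no curve,
Σ is NOT proved. Fourth companion of `…IrreducibleRows.lean` (p823764) / `…Composition.lean` (p823868) /
`…MonoCarrier.lean` (p824349). What it settles about the registered research stub Σ (`stub_sigmaIrreducibleOptimalRows`,
VERBATIM below as a conclusion): Σ is the (t′) twin of route `RamifiedHeegnerPair`'s research child Σ★″ (27493), and the
U-lead's tightness analysis (`RamifiedHeegnerPairLeafSigmaStarTightAllRows.lean`, lead bsd-line-rhp-p2 g6) transfers:

* §1 `pDiv_of_upper_of_twistUpper_rankOne_of_irreducible` — DATA level, generic additive `3 ∣ N`, `E[3]` IRREDUCIBLE,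
  rank-one orientation: on one Heegner frame `(Dt, H, ι, P = y_K)` with odd `d_K` and `L(E^{(d_K)},1) ≠ 0`, the two
  SEPARATE Euler-system halves `ord₃ #Ш(E) ≤ ord₃ #Ш_an(E)` and `ord₃ #Ш(E^{(d_K)}) ≤ ord₃ #Ш_an(E^{(d_K)})`
  (`Typed.MissingUpperBoundAt`) force every derived Heegner point `P_n` (`n` square-free, Kolyvagin primes of index
  `≥ s′`) to be `3^{s′}`-divisible for all `s′ ≤ ord₃ ∏_ℓ c_ℓ(E) + v₃|c(Dt)|`. Proof = the U-lead's
  `pDiv_of_bsdp_of_partner_bsdp_rankOne_of_irreducible` with its last line (`BSD₃`-pair ⟹ co-STEP-L socket) replaced by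
  SOED's `indexUpperBoundLeAt_of_missingUpper_of_missingUpper` (the two upper halves ⟹ the same socket, reused BY NAME —
  the gate's dedup rule — at the price of one disclosed `lint.theses-cone` warning on that import): a FAILURE of
  divisibility at depth `M + 1` is a Kolyvagin certificate, so Matar–Nekovář 2019 §0.11 (named fact, irreducible image)
  gives `3^{2(M₀−M)} ∣ #Ш(E/K)[3^∞]` with `M₀ = ord₃ [E(K) : ℤ y_K]`, while the socket reads
  `ord₃ #Ш(E/K) + 2·ord₃ ∏c_ℓ + 2·v₃|c| ≤ 2·M₀`; `omega`.
* §2 `sigmaIrreducibleOptimalRows_of_upperRankOne_of_upperRankZero` — **Σ VERBATIM ⟸ PUB + U₁ + U₀**, where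
  U₁ / U₀ = the typed upper half at `3` on the non-CM (t′) rows with `E[3]` irreducible of analytic rank `1` / `0`
  (the Heegner twist of such a row is such a row: `tprime_twist_of_heegner`, irreducibility is twist-invariant —
  Silverman X.5.4, tree `hasIrreducibleModPGaloisRep_quadraticTwist_iff`). Σ's Manin binder `3 ∤ c(Dt)` and its
  non-torsion binder are IDLE here (the budget `ord₃ ∏c_ℓ ≤ ord₃ ∏c_ℓ + v₃|c|`).
* §3 `sigmaIrreducibleOptimalRows_of_bsdp` — Σ VERBATIM ⟸ PUB + `BSD₃` (Miller's `BSDp · 3`) on the non-CM (t′) rows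
  with `E[3]` irreducible and analytic rank `≤ 1`. So a counterexample to Σ (ONE derived Heegner point at admissible
  Kolyvagin primes not divisible to the budget) is a counterexample to BSD₃ on the (t′) leaf: Σ is CONSISTENT and
  carries no surplus; the disprover's budget-raising obstructions of Σ★″ (`…Negative/IndexThreshold.lean`) apply verbatim.
* §4 `upperManinClean_iff_sigma_of_pub_of_lowerRankZero_of_upperRankZero` — the SANDWICH, by name: modulo PUB, the
  rank-zero LOWER half L₀ (KT 19981 @ 3 / the registered `stub_tprimeLowerHalfRankZeroAtThree`) and the rank-zero UPPER
  half U₀, Σ is EQUIVALENT to «U₁ on the rows carrying a Manin-clean datum» ((←) = p823764's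
  `tprime_upper_three_of_irreducible_of_sigmaAtDatum_of_lowerRankZero`, (→) = §2): the research content of Σ is EXACTLY
  the `3`-adic Gross–Zagier–Kolyvagin upper half on the irreducible (t′) rank-one optimal rows — Jetchev's Conj. 1.3
  `≥`-half at the additive prime `3` — no surplus, no discount.

References: [cite: MatarNekovar2019, Thm. 0.7 (p. 456) and §0.11 (p. 457)] [cite: McCallumLMS1991, §5 Cor. 5.6 (p. 310)
and Lemma 5.1 (p. 303)] [cite: Jetchev2008, Conj. 1.3, Thm. 1.4, Cor. 1.5 (p. 812)] [cite: GrossZagier1986, Thm. I.(6.3)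
and (7.3)] [cite: Miller2011LMS, Def. 1.1] [cite: SilvermanAEC2009, X.5 Cor. 5.4] [cite: JetchevSkinnerWan2017, §7.4.1].
-/

-- D-0017: single-problem summit, so `Summit.BirchSwinnertonDyer.BirchSwinnertonDyer.…` repeats a namespace BY DESIGN.
set_option linter.dupNamespace false
set_option autoImplicit false

noncomputable section

open scoped Classical NumberField
open WeierstrassCurve IsDedekindDomain NumberField Literature Literature.NumberTheory.EllipticCurves
  Literature.NumberTheory.EllipticCurves.ModularForms
  Literature.NumberTheory.EllipticCurves.Rank1Residual
  Literature.NumberTheory.EllipticCurves.Rank1Residual.Typed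
  Literature.NumberTheory.EllipticCurves.KrizLi2019
  Literature.NumberTheory.QuadraticFields
  Summit.BirchSwinnertonDyer.Rank1Residual
  Summit.BirchSwinnertonDyer.Rank1Residual.Additive
  Summit.BirchSwinnertonDyer.Rank1Residual.X11b
  Summit.BirchSwinnertonDyer.Rank1Residual.X11b.Three
  Summit.BirchSwinnertonDyer.BirchSwinnertonDyer.Theorems
  Summit.BirchSwinnertonDyer.BirchSwinnertonDyer.Theorems.SchneiderFree
  Summit.BirchSwinnertonDyer.BirchSwinnertonDyer.Theorems.SchneiderFree.Upper
  Summit.BirchSwinnertonDyer.BirchSwinnertonDyer.Theorems.RamifiedPairUpperBound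

namespace Summit.BirchSwinnertonDyer.BirchSwinnertonDyer.Theorems.TprimeHeegnerUpperOfManinUnit

/-! ## §1 DATA level: the two separate upper halves force Σ on the frame (rank-one orientation, `E[3]` irreducible) -/

/-- **Σ at one frame from the two UPPER halves `ord₃ #Ш(E) ≤ ord₃ #Ш_an(E)`, `ord₃ #Ш(E^{(d_K)}) ≤ ord₃ #Ш_an(E^{(d_K)})`,
rank-one orientation, IRREDUCIBLE image.** Data: `W/ℚ` globally minimal, non-CM, `3 ∣ N_E`, `E[3]` irreducible,
`r_an(W) = 1`; `K` imaginary quadratic Heegner for `N_E` with odd `d_K` and `L(E^{(d_K)},1) ≠ 0`; the frame `(Dt, H, ι)` with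
`P ↦ y_K`; `Wd` a globally minimal model of the twist. NAMED FACTS (hypotheses): Gross–Zagier `hGZ`, Kolyvagin `hKo`, GZK
`hGZK`, modularity `hmod`, GZ I.(7.3) `hGZ73`, Shimura reciprocity at conductor `1` `hrec`, Darmon Thm. 3.6 `h36`,
Matar–Nekovář 2019 §0.11 in certificate form `hMN`. INPUTS: `hUW : MissingUpperBoundAt W 3`, `hUWd : MissingUpperBoundAt Wd 3`.
OUTPUT: `3^{s′} ∣ P_n` in `E(K[n])` for every `s′ ≤ ord₃ ∏_ℓ c_ℓ(E) + v₃|c(Dt)|`, every square-free `n` and datum `d` of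
conductor `n` whose primes are Kolyvagin of index `≥ s′`. The U-lead's `pDiv_of_bsdp_of_partner_bsdp_rankOne_of_irreducible`
with the `BSD₃`-pair replaced by the two upper halves (SOED `indexUpperBoundLeAt_of_missingUpper_of_missingUpper`).
CONDITIONAL; nothing asserted. [cite: MatarNekovar2019, Thm. 0.7 (p. 456) and §0.11 (p. 457)]
[cite: McCallumLMS1991, §5 Cor. 5.6 (p. 310) and Lemma 5.1 (p. 303)] [cite: GrossZagier1986, Thm. I.(6.3) and (7.3)]
[cite: Miller2011LMS, Def. 1.1] [cite: JetchevSkinnerWan2017, §7.4.1] -/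
theorem pDiv_of_upper_of_twistUpper_rankOne_of_irreducible
    (hGZ : ∀ (N : ℕ) [NeZero N] (W : WeierstrassCurve ℚ) (K : Type) [Field K] [NumberField K],
      gross_zagier N W K)
    (hKo : ∀ (N : ℕ) [NeZero N] (W : WeierstrassCurve ℚ) (K : Type) [Field K] [NumberField K],
      kolyvagin N W K)
    (hGZK : rank_eq_analyticRank_of_analyticRank_le_one) (hmod : hasEntireLFunction_rat)
    (hGZ73 : GrossZagier1986_thm_I_7_3)
    (hrec : ∀ (N : ℕ) [NeZero N] (W : WeierstrassCurve ℚ) (K : Type) [Field K] [NumberField K],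
      heegnerPointOfConductor_one_galoisConj N W K)
    (h36 : ∀ (N : ℕ) [NeZero N] (W : WeierstrassCurve ℚ) (K : Type) [Field K] [NumberField K],
      phi_heegnerTau_mem_range_map_singularModuliField N W K)
    (hMN : MatarNekovar2019.thm07_pow_dvd_card_sha_primary_of_certificate_of_irreducible)
    (W : WeierstrassCurve ℚ) [W.IsElliptic] [W.IsGloballyMinimal] (N : ℕ) [NeZero N]
    (K : Type) [Field K] [NumberField K]
    (Dt : ModularParametrizationData W N) (H : HeegnerDatum N (NumberField.discr K)) (ι : K →+* ℂ)
    (P : (W.baseChange K).toAffine.Point)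
    (hCM : ¬ W.HasCM) (h3N : 3 ∣ W.conductorNorm ℤ) (hN : W.conductorNorm ℤ = N)
    (hirr : W.HasIrreducibleModPGaloisRep 3)
    (hK : IsImaginaryQuadratic K) (hHN : SatisfiesHeegnerHypothesis N K) (hodd : Odd (NumberField.discr K))
    (hr : W.analyticRank = 1) (hLt : (W.quadraticTwist (NumberField.discr K : ℚ)).entireLFunction 1 ≠ 0)
    (hP : WeierstrassCurve.Affine.Point.map ι.toRatAlgHom P = heegnerPointComplex Dt H)
    (Wd : WeierstrassCurve ℚ) [Wd.IsElliptic] [Wd.IsGloballyMinimal] (Cd : VariableChange ℚ)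
    (hWd : Cd • W.quadraticTwist (NumberField.discr K : ℚ) = Wd)
    (hUW : MissingUpperBoundAt W 3) (hUWd : MissingUpperBoundAt Wd 3)
    {s' : ℕ} (hs' : s' ≤ padicValNat 3 W.tamagawaProduct + padicValNat 3 Dt.c.natAbs)
    {n : ℕ} (d : KolyvaginHeegnerData Dt H.β ι n) (hn : Squarefree n)
    (hℓ : ∀ ℓ ∈ n.primeFactors, Zhang2014.IsKolyvaginPrime N W K 3 ℓ ∧ s' ≤ Zhang2014.kolyvaginIndex W 3 ℓ) :
    Koly.PDiv d 3 s' := by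
  haveI h3p : Fact (Nat.Prime 3) := ⟨Nat.prime_three⟩
  have hp2 : (3 : ℕ) ≠ 2 := by decide
  subst hN
  -- `s' = 0` is trivial
  rcases Nat.eq_zero_or_pos s' with hs0 | hs0
  · subst hs0
    exact ⟨d.derivedPoint, by simp⟩
  obtain ⟨M, rfl⟩ : ∃ M, s' = M + 1 := ⟨s' - 1, by omega⟩
  by_contra hcert
  -- `3 ∣ N_W` splits in `K`: `3 ∤ d_K`, `3 ∤ #𝓞_K^×`; `d_K ≠ -3, -4`
  obtain ⟨hd3, hμ⟩ := X11b.Three.not_dvd_discr_and_not_dvd_torsionOrder_of_heegner hK hHN hp2 h3N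
  have h3 : NumberField.discr K ≠ -3 := fun h ↦ hd3 (h ▸ ⟨-1, by norm_num⟩)
  have h4 : NumberField.discr K ≠ -4 := fun h ↦ by
    rw [h] at hodd
    exact (Int.not_odd_iff_even.mpr ⟨-2, by norm_num⟩) hodd
  -- the conductor-`1` Kolyvagin–Heegner datum (Darmon Thm. 3.6) with `P_1 = y_K = P` in `E(K̄)` (Shimura reciprocity)
  obtain ⟨d₁⟩ := nonempty_kolyvaginHeegnerData_one_of_darmon36 (h36 _ W K) hK Dt H.β ι H.dvd_sq_sub
  have hPd : d₁.toGeomPoints d₁.derivedPoint = toGeomPoints (W.baseChange K) P :=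
    KolyvaginBottom.toGeomPoints_derivedPoint_one_eq (hrec _ W K) hK hHN hP d₁ rfl
  -- `P` non-torsion (Gross–Zagier), rank one and `Ш(E/K)` finite (Kolyvagin)
  have hPinf : ¬ IsOfFinAddOrder P :=
    not_isOfFinAddOrder_of_heegner_of_analyticRank_eq_one W (W.conductorNorm ℤ) K Dt H ι P (hGZ _ W K) hmod hr hK
      hHN hLt hP
  obtain ⟨hrank, hSha⟩ := hKo (W.conductorNorm ℤ) W K hK hHN ⟨Dt, H, ι, hP⟩ hPinf
  haveI : Finite (W.baseChange K).sha := hSha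
  -- `E(K)[3] = 0`
  have hbot := torsionBy_eq_bot_of_isImaginaryQuadratic_of_hasIrreducibleModPGaloisRep W K hK Nat.prime_three hirr
  have hiv : ∀ x : (W.baseChange K).toAffine.Point, (3 : ℕ) • x = 0 → x = 0 := fun x hx ↦ by
    have hmem : x ∈ AddSubgroup.torsionBy (W.baseChange K).toAffine.Point (((3 : ℕ) : ℕ) : ℤ) := by
      rw [mem_torsionBy_iff, natCast_zsmul]
      exact hx
    rw [hbot] at hmem
    exact hmem
  -- `3^{M₀} ∥ P` in `E(K)`
  haveI : Module.Finite ℤ (W.baseChange K).toAffine.Point := (W.baseChange K).module_finite_point_holds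
  obtain ⟨M₀, x₀, hx₀, hmax⟩ := exists_pow_smul_eq_and_forall_ne hPinf (p := 3) Nat.prime_three.two_le
  have hdiv : ∃ Q : (W.baseChange K).toAffine.Point, ((3 ^ M₀ : ℕ) : ℤ) • Q = P :=
    ⟨x₀, by rw [natCast_zsmul]; exact hx₀⟩
  have hndiv : ¬ ∃ Q : (W.baseChange K).toAffine.Point, ((3 ^ (M₀ + 1) : ℕ) : ℤ) • Q = P := by
    rintro ⟨Q, hQ⟩
    exact hmax Q (by rw [← natCast_zsmul]; exact hQ)
  -- Matar–Nekovář §0.11 at the certificate: `2(M₀ − M) ≤ ord₃ #Ш(E/K)[3^∞]`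
  have hdvd := hMN W hCM K hK h3 h4 hHN 3 hp2 hirr Dt H.β ι d₁ P hPd hPinf M₀ hdiv hndiv n M d hn hℓ hcert
  have hcard : Nat.card (AddCommGroup.primaryComponent (W.baseChange K).sha 3) ≠ 0 := Nat.card_pos.ne'
  have hMc' : 2 * (M₀ - M) ≤ padicValNat 3 (Nat.card (AddCommGroup.primaryComponent (W.baseChange K).sha 3)) :=
    (padicValNat_dvd_iff_le hcard).mp hdvd
  have hsha : padicValNat 3 (W.baseChange K).shaOrder =
      padicValNat 3 (Nat.card (AddCommGroup.primaryComponent (W.baseChange K).sha 3)) :=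
    Three.Koly.padicValNat_shaOrder_eq (W.baseChange K) 3
  -- `ord₃ [E(K) : ℤP] = M₀`
  haveI : Finite (AddCommGroup.torsion (W.baseChange K).toAffine.Point) :=
    WeierstrassCurve.finite_torsion_point (W := W.baseChange K)
  obtain ⟨c, Q, hcQ, hcker⟩ := RankOne.exists_coord_of_mordellWeilRank_eq_one (W.baseChange K) hrank
  have hidx : padicValNat 3 (AddSubgroup.zmultiples P).index = M₀ :=
    Three.Koly.padicValNat_index_zmultiples_eq_of_divisibility c Q hcQ hcker hiv P hdiv hndiv
  -- the two upper halves: the co-STEP-L socket at slack `v₃|c|`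
  have hup : IndexUpperBoundLeAt W 3 K P (padicValNat 3 Dt.c.natAbs) :=
    WildKolyvaginUpperAtThreeOfJointUpper.indexUpperBoundLeAt_of_missingUpper_of_missingUpper hGZ hKo hGZK hmod
      hGZ73 W 3 (W.conductorNorm ℤ) K Dt H ι P Wd hr rfl h3N hK hodd hμ hHN hLt hP ⟨Cd, hWd⟩ hp2 hUW hUWd
  unfold IndexUpperBoundLeAt at hup
  rw [hidx, hsha] at hup
  omega

/-! ## §2 Σ VERBATIM from the upper halves on the non-CM (t′) rows with `E[3]` irreducible, analytic ranks `1` and `0` -/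

/-- **The registered research stub Σ (`stub_sigmaIrreducibleOptimalRows` of `rows_of_manin_unit` v2, conclusion VERBATIM)
⟸ PUB + U₁ + U₀.** U₁ (`hU1`): the typed upper half at `3` (`ord₃ #Ш(V) ≤ ord₃ #Ш_an(V)`) on every globally minimal
non-CM curve additive of type (t′) at `3` with `V[3]` irreducible and `r_an(V) = 1`; U₀ (`hU0`): the same on analytic rank
`0`. PUB = the eight named facts of §1. On Σ's frame the Heegner twist `E^{(d_K)}` (globally minimal model) is again a
non-CM (t′) row (`tprime_twist_of_heegner`) with `E^{(d_K)}[3]` irreducible (twist invariance, Silverman X.5.4) and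
`r_an = 0` (`L(E^{(d_K)},1) ≠ 0`), so U₀ serves it; then §1. Σ's binders `3 ∤ c(Dt)` and `¬ IsOfFinAddOrder P` are idle.
HONEST READING: Σ carries no surplus over the `3`-adic Euler-system halves of BSD on the irreducible (t′) rows.
CONDITIONAL; closes nothing. [cite: MatarNekovar2019, Thm. 0.7 (p. 456) and §0.11 (p. 457)] [cite: Jetchev2008, Conj. 1.3
(p. 812)] [cite: SilvermanAEC2009, X.5 Cor. 5.4] [cite: GrossZagier1986, Thm. I.(6.3) and (7.3)] [cite: Miller2011LMS, Def. 1.1] -/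
theorem sigmaIrreducibleOptimalRows_of_upperRankOne_of_upperRankZero
    (hGZ : ∀ (N : ℕ) [NeZero N] (W : WeierstrassCurve ℚ) (K : Type) [Field K] [NumberField K],
      gross_zagier N W K)
    (hKo : ∀ (N : ℕ) [NeZero N] (W : WeierstrassCurve ℚ) (K : Type) [Field K] [NumberField K],
      kolyvagin N W K)
    (hGZK : rank_eq_analyticRank_of_analyticRank_le_one) (hmod : hasEntireLFunction_rat)
    (hGZ73 : GrossZagier1986_thm_I_7_3)
    (hrec : ∀ (N : ℕ) [NeZero N] (W : WeierstrassCurve ℚ) (K : Type) [Field K] [NumberField K],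
      heegnerPointOfConductor_one_galoisConj N W K)
    (h36 : ∀ (N : ℕ) [NeZero N] (W : WeierstrassCurve ℚ) (K : Type) [Field K] [NumberField K],
      phi_heegnerTau_mem_range_map_singularModuliField N W K)
    (hMN : MatarNekovar2019.thm07_pow_dvd_card_sha_primary_of_certificate_of_irreducible)
    (hU1 : ∀ (V : WeierstrassCurve ℚ) [V.IsElliptic] [V.IsGloballyMinimal],
      ¬ V.HasCM → Addv V 3 → SubTprime V 3 → V.HasIrreducibleModPGaloisRep 3 → V.analyticRank = 1 →
        MissingUpperBoundAt V 3)
    (hU0 : ∀ (V : WeierstrassCurve ℚ) [V.IsElliptic] [V.IsGloballyMinimal],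
      ¬ V.HasCM → Addv V 3 → SubTprime V 3 → V.HasIrreducibleModPGaloisRep 3 → V.analyticRank = 0 →
        MissingUpperBoundAt V 3) :
    ∀ (W : WeierstrassCurve ℚ) [W.IsElliptic] [W.IsGloballyMinimal] [NeZero (W.conductorNorm ℤ)]
      (K : Type) [Field K] [NumberField K] (Dt : ModularParametrizationData W (W.conductorNorm ℤ))
      (H : HeegnerDatum (W.conductorNorm ℤ) (NumberField.discr K)) (ι : K →+* ℂ) (P : (W.baseChange K).toAffine.Point),
      ¬ W.HasCM → Addv W 3 → SubTprime W 3 → W.HasIrreducibleModPGaloisRep 3 → W.analyticRank = 1 →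
      ¬ (3 : ℤ) ∣ Dt.c → IsImaginaryQuadratic K → SatisfiesHeegnerHypothesis (W.conductorNorm ℤ) K →
      (W.quadraticTwist (NumberField.discr K : ℚ)).entireLFunction 1 ≠ 0 →
      WeierstrassCurve.Affine.Point.map ι.toRatAlgHom P = heegnerPointComplex Dt H → ¬ IsOfFinAddOrder P →
      Odd (NumberField.discr K) →
      ∀ (s' : ℕ), s' ≤ padicValNat 3 W.tamagawaProduct →
      ∀ (n : ℕ) (d : KolyvaginHeegnerData Dt H.β ι n), Squarefree n →
      (∀ ℓ ∈ n.primeFactors, Zhang2014.IsKolyvaginPrime (W.conductorNorm ℤ) W K 3 ℓ ∧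
        s' ≤ Zhang2014.kolyvaginIndex W 3 ℓ) → Koly.PDiv d 3 s' := by
  intro W _ _ _ K _ _ Dt H ι P hCM hadd hT hirr hr _ hK hHN hLt hP _ hodd s' hs' n d hn hℓ
  have h3N : 3 ∣ W.conductorNorm ℤ :=
    (W.dvd_conductorNorm_iff_not_hasGoodReductionAtPrime 3).mpr (not_good_of_addv W 3 hadd)
  -- a globally minimal model of the Heegner twist: a non-CM (t′) row with `E[3]` irreducible and analytic rank `0`
  have hD0 : (NumberField.discr K : ℚ) ≠ 0 := by exact_mod_cast NumberField.discr_ne_zero K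
  haveI hEt : (W.quadraticTwist (NumberField.discr K : ℚ)).IsElliptic := W.isElliptic_quadraticTwist hD0
  obtain ⟨Cd, hCd⟩ := hasGlobalMinimalModel_rat_holds (W.quadraticTwist (NumberField.discr K : ℚ))
  haveI : (Cd • W.quadraticTwist (NumberField.discr K : ℚ)).IsGloballyMinimal := hCd
  have hrd : (Cd • W.quadraticTwist (NumberField.discr K : ℚ)).analyticRank = 0 := by
    rw [analyticRank_smul]
    exact analyticRank_eq_zero_of_entireLFunction_one_ne_zero _ hLt
  obtain ⟨hCMd, haddd, hTd, -⟩ := tprime_twist_of_heegner W hCM hadd hT K hK hHN hodd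
    (Cd • W.quadraticTwist (NumberField.discr K : ℚ)) Cd rfl
  have hirrd : (Cd • W.quadraticTwist (NumberField.discr K : ℚ)).HasIrreducibleModPGaloisRep 3 :=
    (Mazur1978.hasIrreducibleModPGaloisRep_smul_iff _ Cd 3).mpr
      ((W.hasIrreducibleModPGaloisRep_quadraticTwist_iff hD0 3).mpr hirr)
  -- the two upper halves on the frame, then §1 (budget `ord₃ ∏c_ℓ ≤ ord₃ ∏c_ℓ + v₃|c|`)
  exact pDiv_of_upper_of_twistUpper_rankOne_of_irreducible hGZ hKo hGZK hmod hGZ73 hrec h36 hMN W (W.conductorNorm ℤ)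
    K Dt H ι P hCM h3N rfl hirr hK hHN hodd hr hLt hP (Cd • W.quadraticTwist (NumberField.discr K : ℚ)) Cd rfl
    (hU1 W hCM hadd hT hirr hr) (hU0 _ hCMd haddd hTd hirrd hrd) (le_trans hs' (Nat.le_add_right _ _)) d hn hℓ

/-! ## §3 Σ VERBATIM from `BSD₃` on the non-CM (t′) rows with `E[3]` irreducible and analytic rank `≤ 1` -/

/-- **Σ (conclusion VERBATIM) ⟸ PUB + `BSD₃` on the irreducible (t′) rows of analytic rank `≤ 1`** (`hB`: Miller's
`BSDp V 3` for every globally minimal non-CM `V` additive of type (t′) at `3` with `V[3]` irreducible and `r_an(V) ≤ 1`).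
Each `BSD₃` gives its curve's upper half (`missingPPartAt_of_bsdp`, `Ш` finite by GZK), then §2. CONSEQUENCE: a
counterexample to Σ — one derived Heegner point `P_n` at Kolyvagin primes of index `≥ s′ ≤ ord₃ ∏c_ℓ(E)` that is not
`3^{s′}`-divisible in `E(K[n])` — refutes `BSD₃` at `E` or at `E^{(d_K)}`; Σ is consistent with BSD and not cheaply refutable.
CONDITIONAL; closes nothing. [cite: Miller2011LMS, Def. 1.1] [cite: MatarNekovar2019, §0.11 (p. 457)]
[cite: Jetchev2008, Conj. 1.3 (p. 812)] [cite: GrossZagier1986, Thm. I.(6.3) and (7.3)] -/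
theorem sigmaIrreducibleOptimalRows_of_bsdp
    (hGZ : ∀ (N : ℕ) [NeZero N] (W : WeierstrassCurve ℚ) (K : Type) [Field K] [NumberField K],
      gross_zagier N W K)
    (hKo : ∀ (N : ℕ) [NeZero N] (W : WeierstrassCurve ℚ) (K : Type) [Field K] [NumberField K],
      kolyvagin N W K)
    (hGZK : rank_eq_analyticRank_of_analyticRank_le_one) (hmod : hasEntireLFunction_rat)
    (hGZ73 : GrossZagier1986_thm_I_7_3)
    (hrec : ∀ (N : ℕ) [NeZero N] (W : WeierstrassCurve ℚ) (K : Type) [Field K] [NumberField K],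
      heegnerPointOfConductor_one_galoisConj N W K)
    (h36 : ∀ (N : ℕ) [NeZero N] (W : WeierstrassCurve ℚ) (K : Type) [Field K] [NumberField K],
      phi_heegnerTau_mem_range_map_singularModuliField N W K)
    (hMN : MatarNekovar2019.thm07_pow_dvd_card_sha_primary_of_certificate_of_irreducible)
    (hB : ∀ (V : WeierstrassCurve ℚ) [V.IsElliptic] [V.IsGloballyMinimal],
      ¬ V.HasCM → Addv V 3 → SubTprime V 3 → V.HasIrreducibleModPGaloisRep 3 → V.analyticRank ≤ 1 → BSDp V 3) :
    ∀ (W : WeierstrassCurve ℚ) [W.IsElliptic] [W.IsGloballyMinimal] [NeZero (W.conductorNorm ℤ)]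
      (K : Type) [Field K] [NumberField K] (Dt : ModularParametrizationData W (W.conductorNorm ℤ))
      (H : HeegnerDatum (W.conductorNorm ℤ) (NumberField.discr K)) (ι : K →+* ℂ) (P : (W.baseChange K).toAffine.Point),
      ¬ W.HasCM → Addv W 3 → SubTprime W 3 → W.HasIrreducibleModPGaloisRep 3 → W.analyticRank = 1 →
      ¬ (3 : ℤ) ∣ Dt.c → IsImaginaryQuadratic K → SatisfiesHeegnerHypothesis (W.conductorNorm ℤ) K →
      (W.quadraticTwist (NumberField.discr K : ℚ)).entireLFunction 1 ≠ 0 →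
      WeierstrassCurve.Affine.Point.map ι.toRatAlgHom P = heegnerPointComplex Dt H → ¬ IsOfFinAddOrder P →
      Odd (NumberField.discr K) →
      ∀ (s' : ℕ), s' ≤ padicValNat 3 W.tamagawaProduct →
      ∀ (n : ℕ) (d : KolyvaginHeegnerData Dt H.β ι n), Squarefree n →
      (∀ ℓ ∈ n.primeFactors, Zhang2014.IsKolyvaginPrime (W.conductorNorm ℤ) W K 3 ℓ ∧
        s' ≤ Zhang2014.kolyvaginIndex W 3 ℓ) → Koly.PDiv d 3 s' := by
  haveI h3p : Fact (Nat.Prime 3) := ⟨Nat.prime_three⟩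
  have hU : ∀ (V : WeierstrassCurve ℚ) [V.IsElliptic] [V.IsGloballyMinimal],
      ¬ V.HasCM → Addv V 3 → SubTprime V 3 → V.HasIrreducibleModPGaloisRep 3 → V.analyticRank ≤ 1 →
        MissingUpperBoundAt V 3 := by
    intro V _ _ hCM hadd hT hirr hr
    obtain ⟨-, hfin⟩ := hGZK V hr
    haveI : Finite V.sha := hfin
    exact (lower_and_upper_of_missingPPartAt V 3 (missingPPartAt_of_bsdp V 3 (hB V hCM hadd hT hirr hr))).2
  exact sigmaIrreducibleOptimalRows_of_upperRankOne_of_upperRankZero hGZ hKo hGZK hmod hGZ73 hrec h36 hMN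
    (fun V _ _ hCM hadd hT hirr hr ↦ hU V hCM hadd hT hirr (by rw [hr]))
    (fun V _ _ hCM hadd hT hirr hr ↦ hU V hCM hadd hT hirr (by rw [hr]; exact zero_le_one))

/-! ## §4 The sandwich: modulo PUB, L₀ and U₀, Σ is EQUIVALENT to the upper half on the rows carrying a Manin-clean datum -/

/-- **The sandwich, by name.** Modulo the named facts (PUB of §1 together with the composition's Matar–Nekovář Thm. 0.7
reading `hMN'`, newform existence `hnf`, Friedberg–Hoffstein `hFH`), the non-CM (t′) rank-ZERO LOWER half at `3` (`hL0`,
= the registered `stub_tprimeLowerHalfRankZeroAtThree` / KT 19981 @ 3) and the non-CM (t′) irreducible rank-ZERO UPPER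
half at `3` (`hU0`), the registered research stub Σ (VERBATIM) is EQUIVALENT to U₁ᴹ := «`Typed.MissingUpperBoundAt W 3`
for every globally minimal non-CM (t′) rank-one `W` with `E[3]` irreducible that carries a parametrisation datum at level
`N_E` with `3 ∤ c`» — (→) is p823764's `tprime_upper_three_of_irreducible_of_sigmaAtDatum_of_lowerRankZero` at the
Manin-clean datum (depth `ord₃ ∏c_ℓ + 0`), (←) is §2 (U₁ᴹ feeds U₁ on exactly the rows Σ quantifies over, since Σ itself
carries the Manin-clean datum `Dt`). So the research content of Σ is EXACTLY the `3`-adic Gross–Zagier–Kolyvagin upper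
half on the irreducible (t′) rank-one optimal rows (Jetchev's Conj. 1.3, `≥`-half, at the additive prime `3`): no surplus,
no discount. CONDITIONAL; closes nothing; BSD is proved for no curve. [cite: Jetchev2008, Conj. 1.3 and Thm. 1.4 (p. 812)]
[cite: MatarNekovar2019, Thm. 0.7 (p. 456) and §0.11 (p. 457)] [cite: FriedbergHoffstein1995, Thm. B] [cite: Miller2011LMS, Def. 1.1] -/
theorem upperManinClean_iff_sigma_of_pub_of_lowerRankZero_of_upperRankZero
    (hGZ : ∀ (N : ℕ) [NeZero N] (W : WeierstrassCurve ℚ) (K : Type) [Field K] [NumberField K],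
      gross_zagier N W K)
    (hKo : ∀ (N : ℕ) [NeZero N] (W : WeierstrassCurve ℚ) (K : Type) [Field K] [NumberField K],
      kolyvagin N W K)
    (hGZK : rank_eq_analyticRank_of_analyticRank_le_one) (hmod : hasEntireLFunction_rat)
    (hGZ73 : GrossZagier1986_thm_I_7_3)
    (hrec : ∀ (N : ℕ) [NeZero N] (W : WeierstrassCurve ℚ) (K : Type) [Field K] [NumberField K],
      heegnerPointOfConductor_one_galoisConj N W K)
    (h36 : ∀ (N : ℕ) [NeZero N] (W : WeierstrassCurve ℚ) (K : Type) [Field K] [NumberField K],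
      phi_heegnerTau_mem_range_map_singularModuliField N W K)
    (hMN : MatarNekovar2019.thm07_pow_dvd_card_sha_primary_of_certificate_of_irreducible)
    (hMN' : MatarNekovar2019.thm07_padicValNat_card_sha_primary_add_le_of_globalDivisibility_of_irreducible)
    (hnf : exists_isNewformOf) (hFH : friedbergHoffstein_exists_heegnerField_splitDivisors_twist_ne_zero)
    (hL0 : ∀ (V : WeierstrassCurve ℚ) [V.IsElliptic] [V.IsGloballyMinimal],
      ¬ V.HasCM → Addv V 3 → SubTprime V 3 → V.analyticRank = 0 → MissingLowerBoundAt V 3)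
    (hU0 : ∀ (V : WeierstrassCurve ℚ) [V.IsElliptic] [V.IsGloballyMinimal],
      ¬ V.HasCM → Addv V 3 → SubTprime V 3 → V.HasIrreducibleModPGaloisRep 3 → V.analyticRank = 0 →
        MissingUpperBoundAt V 3) :
    (∀ (W : WeierstrassCurve ℚ) [W.IsElliptic] [W.IsGloballyMinimal] [NeZero (W.conductorNorm ℤ)],
      ¬ W.HasCM → Addv W 3 → SubTprime W 3 → W.HasIrreducibleModPGaloisRep 3 → W.analyticRank = 1 →
      ∀ (D : ModularParametrizationData W (W.conductorNorm ℤ)), ¬ (3 : ℤ) ∣ D.c → MissingUpperBoundAt W 3) ↔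
    (∀ (W : WeierstrassCurve ℚ) [W.IsElliptic] [W.IsGloballyMinimal] [NeZero (W.conductorNorm ℤ)]
      (K : Type) [Field K] [NumberField K] (Dt : ModularParametrizationData W (W.conductorNorm ℤ))
      (H : HeegnerDatum (W.conductorNorm ℤ) (NumberField.discr K)) (ι : K →+* ℂ) (P : (W.baseChange K).toAffine.Point),
      ¬ W.HasCM → Addv W 3 → SubTprime W 3 → W.HasIrreducibleModPGaloisRep 3 → W.analyticRank = 1 →
      ¬ (3 : ℤ) ∣ Dt.c → IsImaginaryQuadratic K → SatisfiesHeegnerHypothesis (W.conductorNorm ℤ) K →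
      (W.quadraticTwist (NumberField.discr K : ℚ)).entireLFunction 1 ≠ 0 →
      WeierstrassCurve.Affine.Point.map ι.toRatAlgHom P = heegnerPointComplex Dt H → ¬ IsOfFinAddOrder P →
      Odd (NumberField.discr K) →
      ∀ (s' : ℕ), s' ≤ padicValNat 3 W.tamagawaProduct →
      ∀ (n : ℕ) (d : KolyvaginHeegnerData Dt H.β ι n), Squarefree n →
      (∀ ℓ ∈ n.primeFactors, Zhang2014.IsKolyvaginPrime (W.conductorNorm ℤ) W K 3 ℓ ∧
        s' ≤ Zhang2014.kolyvaginIndex W 3 ℓ) → Koly.PDiv d 3 s') := by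
  constructor
  · -- (→): U₁ᴹ gives U₁ on every row Σ quantifies over (Σ carries the Manin-clean datum `Dt`), then §2 at the frame
    intro hUM W _ _ _ K _ _ Dt H ι P hCM hadd hT hirr hr hc hK hHN hLt hP hnt hodd s' hs' n d hn hℓ
    have h3N : 3 ∣ W.conductorNorm ℤ :=
      (W.dvd_conductorNorm_iff_not_hasGoodReductionAtPrime 3).mpr (not_good_of_addv W 3 hadd)
    have hD0 : (NumberField.discr K : ℚ) ≠ 0 := by exact_mod_cast NumberField.discr_ne_zero K
    haveI hEt : (W.quadraticTwist (NumberField.discr K : ℚ)).IsElliptic := W.isElliptic_quadraticTwist hD0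
    obtain ⟨Cd, hCd⟩ := hasGlobalMinimalModel_rat_holds (W.quadraticTwist (NumberField.discr K : ℚ))
    haveI : (Cd • W.quadraticTwist (NumberField.discr K : ℚ)).IsGloballyMinimal := hCd
    have hrd : (Cd • W.quadraticTwist (NumberField.discr K : ℚ)).analyticRank = 0 := by
      rw [analyticRank_smul]
      exact analyticRank_eq_zero_of_entireLFunction_one_ne_zero _ hLt
    obtain ⟨hCMd, haddd, hTd, -⟩ := tprime_twist_of_heegner W hCM hadd hT K hK hHN hodd
      (Cd • W.quadraticTwist (NumberField.discr K : ℚ)) Cd rfl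
    have hirrd : (Cd • W.quadraticTwist (NumberField.discr K : ℚ)).HasIrreducibleModPGaloisRep 3 :=
      (Mazur1978.hasIrreducibleModPGaloisRep_smul_iff _ Cd 3).mpr
        ((W.hasIrreducibleModPGaloisRep_quadraticTwist_iff hD0 3).mpr hirr)
    exact pDiv_of_upper_of_twistUpper_rankOne_of_irreducible hGZ hKo hGZK hmod hGZ73 hrec h36 hMN W (W.conductorNorm ℤ)
      K Dt H ι P hCM h3N rfl hirr hK hHN hodd hr hLt hP (Cd • W.quadraticTwist (NumberField.discr K : ℚ)) Cd rfl
      (hUM W hCM hadd hT hirr hr Dt hc) (hU0 _ hCMd haddd hTd hirrd hrd) (le_trans hs' (Nat.le_add_right _ _)) d hn hℓ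
  · -- (←): p823764's upper half from Σ at the Manin-clean datum (depth `ord₃ ∏c_ℓ + v₃|c| = ord₃ ∏c_ℓ`) and L₀
    intro hSig W _ _ _ hCM hadd hT hirr hr D hc
    have hc0 : padicValNat 3 D.c.natAbs = 0 :=
      padicValNat.eq_zero_of_not_dvd fun h ↦ hc (Int.ofNat_dvd_left.mpr h)
    refine tprime_upper_three_of_irreducible_of_sigmaAtDatum_of_lowerRankZero hGZ hKo hGZK hmod hGZ73 hMN' hnf hFH hL0
      W hCM hadd hT hirr hr D ?_
    intro K _ _ H ι P hK hHN hLt hP hnt hodd s' hs' n d hn hℓ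
    exact hSig W K D H ι P hCM hadd hT hirr hr hc hK hHN hLt hP hnt hodd s' (by omega) n d hn hℓ

end Summit.BirchSwinnertonDyer.BirchSwinnertonDyer.Theorems.TprimeHeegnerUpperOfManinUnit

end
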